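import Literature.NumberTheory.Sieve.BombieriFriedlanderIwaniecTheorem5Assembly
import HarnessLib

/-!
# Bombieri–Friedlander–Iwaniec 1986, Theorem 5 — step 5: reciprocity, `𝓔` versus `𝒜`, Theorem 5 from Lemma 6

Topic `Literature/NumberTheory/Sieve`; continuation of `…Theorem5Assembly`.  BFI prove their
Lemma 9 (the bound for `𝓔` used in Theorem 5) in two lines from Lemma 6 (the bound (8.4) for the
sum `𝒜` of §8, itself a consequence of Lemma 1 = Deshouillers–Iwaniec, Invent. Math. 70 (1982),
Theorem 12), p. 236: "This easily follows from Lemma 6 because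
`𝓔(C,D,H,R) ≤ 𝒜(D,C,1,H,R) + O((|a|H log 2RCD)²)`. To see this apply the 'reciprocity' relation
`d̄/cr ≡ −(cr)‾/d + 1/cdr (mod 1)` giving `e(ah d̄/cr) = e(−ah (cr)‾/d) + O(|a|h/cdr)`."
This file PROVES that step (in the explicit form `𝓔 ≤ 2𝒜 + 32π²a²H⁴R²`) and deduces Theorem 5
from Lemma 6.  Everything here is PROVED; no named facts are introduced.

## Contents

* `BFI.dispA a C D K H Q α` — BFI's `𝒜(C,D,K,H,Q)` ((8.2)–(8.3), p. 226) for coefficients `α(h,q)`.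
* `BFI.reciprocity_dvd` (`crd ∣ ρd − ρ'cr − a` for `ρ = a d̄ mod cr`, `ρ' = (−a)(cr)‾ mod d`),
  `BFI.e_reciprocity` (`e(hρ/(cr)) = e(hρ'/d) e(ah/(cdr))`), `BFI.norm_e_sub_e_reciprocity_le`
  (`|e(hρ/(cr)) − e(hρ'/d)| ≤ 2π|a|h/(cdr)`), `BFI.norm_innerE_sub_innerA_le`.
* **`BFI.dispE_le_dispA`**: `𝓔(a; C,D,H,R; δ) ≤ 2𝒜(−a; D,C,1,H,R; δ) + 32π²a²⌊H⌋⁴⌊R⌋²` (`|δ| ≤ 1`).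
* **`BombieriFriedlanderIwaniecTheorem5_of_lemma6`** — Lemma 6 (as printed, for all `a ≠ 0`,
  `ε > 0`, `C,D,K,H,Q ≥ 1`, all `|α| ≤ 1`) implies the named fact
  `BombieriFriedlanderIwaniecTheorem5`; the reciprocity error `≪ a²H⁴R²` is admissible in the range
  (12.5) (it is `≤ 128π²a² x^{1−22ε₁} QR²/M` by `x^εQ < M` and `x^εQR⁴ < xM`).

## What remains for `BombieriFriedlanderIwaniecTheorem5_holds`

BFI's Lemma 6 (p. 227: squaring out `𝒜`, the diagonal count, and Lemma 1 for the off-diagonal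
terms with smooth weights `g(c,d)`) and Lemma 1 = Deshouillers–Iwaniec 1982, Theorem 12
(Kuznetsov's formula; spectral theory of `Γ₀(q)∖ℍ`), neither of which is in Mathlib or the tree.

## References

* E. Bombieri, J. B. Friedlander, H. Iwaniec, Acta Math. 156 (1986), 203–251, §8 (8.2)–(8.4)
  pp. 226–227, §12 Lemma 9 p. 236, Theorem 5 p. 237. [BombieriFriedlanderIwaniecActa1986]
-/

noncomputable section

open Finset Real MeasureTheory
open scoped ArithmeticFunction.sigma ContDiff FourierTransform

namespace Literature.NumberTheory.Sieve

namespace BFI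

/-- **BFI's sum `𝒜(C, D, K, H, Q)`** ((8.2)–(8.3), p. 226):
`𝒜 = ∑_{c≤C} ∑_{d≤D} ∑_{k≤K} |∑_{h≤H} ∑_{q≤Q, (dq,c)=1} α(h, q) e(a h k (dq)‾/c)|²` for the residue
`a` and coefficients `α(h, q)` (the source takes the supremum over `|α| ≤ 1`; here `α` is an
argument), the phase written `e(hk·(a (dq)‾ mod c)/c)`; terms with `(dq, c) > 1` are absent.
[cite: BombieriFriedlanderIwaniecActa1986, §8 (8.2)–(8.3) p. 226] -/
def dispA (a : ℤ) (C D K H Q : ℝ) (α : ℕ → ℕ → ℂ) : ℝ :=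
  ∑ c ∈ Finset.Icc 1 ⌊C⌋₊, ∑ d ∈ Finset.Icc 1 ⌊D⌋₊, ∑ k ∈ Finset.Icc 1 ⌊K⌋₊,
    ‖∑ h ∈ Finset.Icc 1 ⌊H⌋₊, ∑ q ∈ (Finset.Icc 1 ⌊Q⌋₊).filter (fun q => c.Coprime (d * q)),
        α h q * (𝐞 (((((a : ZMod c) * ((d * q : ℕ) : ZMod c)⁻¹).val : ℕ) : ℝ) * h * k / c) : ℂ)‖ ^ 2

/-- `𝒜 ≥ 0`. [folklore] -/
theorem dispA_nonneg (a : ℤ) (C D K H Q : ℝ) (α : ℕ → ℕ → ℂ) : 0 ≤ dispA a C D K H Q α :=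
  Finset.sum_nonneg fun _ _ => Finset.sum_nonneg fun _ _ => Finset.sum_nonneg fun _ _ => by positivity

/-- `e(n) = 1` for an integer `n`. [folklore] -/
theorem e_intCast (n : ℤ) : ((𝐞 (n : ℝ) : Circle) : ℂ) = 1 := by
  rw [Real.fourierChar_apply]
  have : ((2 * π * (n : ℝ) : ℝ) : ℂ) * Complex.I = (n : ℂ) * (2 * π * Complex.I) := by
    push_cast; ring
  rw [this, Complex.exp_int_mul_two_pi_mul_I]

/-- `|e(u + θ) − e(u)| ≤ 2π|θ|`. [folklore] -/
theorem norm_e_add_sub_e_le (u θ : ℝ) :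
    ‖((𝐞 (u + θ) : Circle) : ℂ) - ((𝐞 u : Circle) : ℂ)‖ ≤ 2 * π * |θ| := by
  rw [AddChar.map_add_eq_mul, Circle.coe_mul, ← mul_sub_one, norm_mul, Circle.norm_coe, one_mul,
    Real.fourierChar_apply, mul_comm _ Complex.I]
  refine (Real.norm_exp_I_mul_ofReal_sub_one_le).trans (le_of_eq ?_)
  rw [Real.norm_eq_abs, abs_mul, abs_of_pos Real.two_pi_pos]


/-- **The reciprocity relation** (BFI p. 236: "`d̄/cr ≡ −(cr)‾/d + 1/cdr (mod 1)`") as a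
divisibility: for `(d, cr) = 1`, with `ρ = (a d̄ mod cr)` and `ρ' = ((−a)(cr)‾ mod d)`,
`cr · d ∣ ρ d − ρ' cr − a`. [cite: BombieriFriedlanderIwaniecActa1986, §12 p. 236] -/
theorem reciprocity_dvd {c d r : ℕ} (hc : 0 < c) (hd : 0 < d) (hr : 0 < r)
    (hcop : d.Coprime (c * r)) (a : ℤ) :
    ((c * r : ℕ) : ℤ) * (d : ℤ) ∣
      ((((a : ZMod (c * r)) * ((d : ZMod (c * r)))⁻¹).val : ℕ) : ℤ) * d -
        (((((-a : ℤ) : ZMod d) * (((c * r : ℕ) : ZMod d))⁻¹).val : ℕ) : ℤ) * ((c * r : ℕ) : ℤ) - a := by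
  have hk : 0 < c * r := Nat.mul_pos hc hr
  haveI : NeZero (c * r) := ⟨hk.ne'⟩
  haveI : NeZero d := ⟨hd.ne'⟩
  have hcopk : IsCoprime ((c * r : ℕ) : ℤ) (d : ℤ) := Nat.isCoprime_iff_coprime.2 hcop.symm
  refine IsCoprime.mul_dvd hcopk ?_ ?_
  · rw [← ZMod.intCast_zmod_eq_zero_iff_dvd]
    push_cast
    have h0 : (c : ZMod (c * r)) * (r : ZMod (c * r)) = 0 := by
      rw [← Nat.cast_mul]; exact ZMod.natCast_self _
    rw [h0, mul_zero, sub_zero, ZMod.natCast_zmod_val]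
    have hu : (d : ZMod (c * r)) * ((d : ZMod (c * r)))⁻¹ = 1 := ZMod.coe_mul_inv_eq_one d hcop
    calc (a : ZMod (c * r)) * ((d : ZMod (c * r)))⁻¹ * (d : ZMod (c * r)) - a
        = (a : ZMod (c * r)) * ((d : ZMod (c * r)) * ((d : ZMod (c * r)))⁻¹) - a := by ring
      _ = 0 := by rw [hu]; ring
  · rw [← ZMod.intCast_zmod_eq_zero_iff_dvd]
    push_cast
    rw [ZMod.natCast_self, mul_zero, zero_sub, ZMod.natCast_zmod_val]
    have hv : ((c : ZMod d) * r) * ((c : ZMod d) * r)⁻¹ = 1 := by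
      have := ZMod.coe_mul_inv_eq_one (c * r) hcop.symm
      push_cast at this
      exact this
    calc -(-(a : ZMod d) * ((c : ZMod d) * r)⁻¹ * ((c : ZMod d) * r)) - a
        = (a : ZMod d) * (((c : ZMod d) * r) * ((c : ZMod d) * r)⁻¹) - a := by ring
      _ = 0 := by rw [hv]; ring

/-- **The phases of `𝓔` and `𝒜` differ by `e(ah/(cdr))`** (BFI p. 236:
"`e(ah d̄/cr) = e(−ah (cr)‾/d) + O(|a|h/cdr)`", exact form): for `(d, cr) = 1`,
`e(h ρ/(cr)) = e(h ρ'/d) · e(ah/(cdr))`. [cite: BombieriFriedlanderIwaniecActa1986, §12 p. 236] -/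
theorem e_reciprocity {c d r : ℕ} (hc : 0 < c) (hd : 0 < d) (hr : 0 < r)
    (hcop : d.Coprime (c * r)) (a : ℤ) (h : ℕ) :
    ((𝐞 (((((a : ZMod (c * r)) * ((d : ZMod (c * r)))⁻¹).val : ℕ) : ℝ) * h /
        ((c * r : ℕ) : ℝ)) : Circle) : ℂ) =
      ((𝐞 ((((((-a : ℤ) : ZMod d) * (((c * r : ℕ) : ZMod d))⁻¹).val : ℕ) : ℝ) * h * 1 / d) :
          Circle) : ℂ) * ((𝐞 ((a : ℝ) * h / ((c : ℝ) * d * r)) : Circle) : ℂ) := by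
  obtain ⟨t, ht⟩ := reciprocity_dvd hc hd hr hcop a
  have hc0 : (0 : ℝ) < c := by exact_mod_cast hc
  have hd0 : (0 : ℝ) < d := by exact_mod_cast hd
  have hr0 : (0 : ℝ) < r := by exact_mod_cast hr
  set ρ : ℕ := ((a : ZMod (c * r)) * ((d : ZMod (c * r)))⁻¹).val with hρ
  set ρ' : ℕ := (((-a : ℤ) : ZMod d) * (((c * r : ℕ) : ZMod d))⁻¹).val with hρ'
  have ht' : (ρ : ℝ) * d - (ρ' : ℝ) * (c * r) - a = (c * r) * d * t := by
    have := congrArg (fun z : ℤ => (z : ℝ)) ht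
    push_cast at this
    linarith
  have key : (ρ : ℝ) * h / ((c * r : ℕ) : ℝ) =
      (ρ' : ℝ) * h * 1 / d + (a : ℝ) * h / ((c : ℝ) * d * r) + ((h * t : ℤ) : ℝ) := by
    push_cast
    field_simp
    linear_combination (h : ℝ) * ht'
  rw [key, AddChar.map_add_eq_mul, AddChar.map_add_eq_mul, Circle.coe_mul, Circle.coe_mul, e_intCast,
    mul_one]

/-- The phases differ by at most `2π|a|h/(cdr)` in absolute value. [folklore] -/
theorem norm_e_sub_e_reciprocity_le {c d r : ℕ} (hc : 0 < c) (hd : 0 < d) (hr : 0 < r)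
    (hcop : d.Coprime (c * r)) (a : ℤ) (h : ℕ) :
    ‖((𝐞 (((((a : ZMod (c * r)) * ((d : ZMod (c * r)))⁻¹).val : ℕ) : ℝ) * h /
        ((c * r : ℕ) : ℝ)) : Circle) : ℂ) -
      ((𝐞 ((((((-a : ℤ) : ZMod d) * (((c * r : ℕ) : ZMod d))⁻¹).val : ℕ) : ℝ) * h * 1 / d) :
          Circle) : ℂ)‖ ≤ 2 * π * (|(a : ℝ)| * h / ((c : ℝ) * d * r)) := by
  rw [e_reciprocity hc hd hr hcop a h]
  set u : ℝ := (((((-a : ℤ) : ZMod d) * (((c * r : ℕ) : ZMod d))⁻¹).val : ℕ) : ℝ) * h * 1 / d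
  have := norm_e_add_sub_e_le u ((a : ℝ) * h / ((c : ℝ) * d * r))
  rw [AddChar.map_add_eq_mul, Circle.coe_mul] at this
  refine this.trans (le_of_eq ?_)
  congr 1
  rw [abs_div, abs_mul, Nat.abs_cast, abs_of_pos (by positivity : (0 : ℝ) < (c : ℝ) * d * r)]

/-- `‖x‖² ≤ 2‖y‖² + 2‖x − y‖²`. [folklore] -/
theorem norm_sq_le_two_mul {x y : ℂ} : ‖x‖ ^ 2 ≤ 2 * ‖y‖ ^ 2 + 2 * ‖x - y‖ ^ 2 := by
  have h := norm_le_norm_sub_add x y   -- ‖x‖ ≤ ‖x - y‖ + ‖y‖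
  nlinarith [norm_nonneg x, norm_nonneg y, norm_nonneg (x - y), sq_nonneg (‖x - y‖ - ‖y‖)]

/-- `∑_{c=1}^{N} 1/c² ≤ 2`. [folklore] -/
theorem sum_Icc_one_div_sq_le_two (N : ℕ) : ∑ c ∈ Finset.Icc 1 N, (1 : ℝ) / (c : ℝ) ^ 2 ≤ 2 := by
  rcases Nat.eq_zero_or_pos N with h0 | hN
  · subst h0; simp
  · have h : Finset.Icc 1 N = insert 1 (Finset.Icc 2 N) := (Finset.insert_Icc_add_one_left_eq_Icc hN).symm
    rw [h, Finset.sum_insert (by simp)]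
    have h2 := sum_Icc_inv_sq_le_one N
    simp only [one_div] at h2 ⊢
    norm_num
    linarith


/-- The inner sum of `𝒜(−a; D, C, 1, H, R)` at `(c', d') = (d, c)`, `k = 1`: the sum of `𝓔`'s
inner sum with the reciprocal phase `e(h ρ'/d)`. [folklore] -/
def innerA (a : ℤ) (H R : ℝ) (δ : ℕ → ℕ → ℂ) (c d : ℕ) : ℂ :=
  ∑ h ∈ Finset.Icc 1 ⌊H⌋₊, ∑ r ∈ (Finset.Icc 1 ⌊R⌋₊).filter (fun r => d.Coprime (c * r)),
    δ h r * ((𝐞 ((((((-a : ℤ) : ZMod d) * (((c * r : ℕ) : ZMod d))⁻¹).val : ℕ) : ℝ) * h * 1 / d) :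
      Circle) : ℂ)

/-- `𝒜(−a; D, C, 1, H, R) = ∑_{d ≤ D} ∑_{c ≤ C} ‖innerA(c, d)‖²`. [folklore] -/
theorem dispA_neg_one_eq (a : ℤ) (C D H R : ℝ) (δ : ℕ → ℕ → ℂ) :
    dispA (-a) D C 1 H R δ =
      ∑ d ∈ Finset.Icc 1 ⌊D⌋₊, ∑ c ∈ Finset.Icc 1 ⌊C⌋₊, ‖innerA a H R δ c d‖ ^ 2 := by
  unfold dispA innerA
  simp only [Nat.floor_one, Finset.Icc_self, Finset.sum_singleton, Nat.cast_one, Int.cast_neg]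

/-- **The inner sums of `𝓔` and `𝒜` differ by `≤ 2π|a| H² R/(cd)`** (BFI p. 236, the `O(|a|h/cdr)`
summed over `h ≤ H`, `r ≤ R`, for `|δ| ≤ 1`). [cite: BombieriFriedlanderIwaniecActa1986, §12 p. 236] -/
theorem norm_innerE_sub_innerA_le {a : ℤ} (H R : ℝ) {δ : ℕ → ℕ → ℂ} (hδ : ∀ h r, ‖δ h r‖ ≤ 1)
    {c d : ℕ} (hc : 0 < c) (hd : 0 < d) :
    ‖innerE a H R δ c d - innerA a H R δ c d‖ ≤
      2 * π * |(a : ℝ)| * (⌊H⌋₊ : ℝ) ^ 2 * (⌊R⌋₊ : ℝ) / ((c : ℝ) * d) := by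
  have hc0 : (0 : ℝ) < c := by exact_mod_cast hc
  have hd0 : (0 : ℝ) < d := by exact_mod_cast hd
  unfold innerE innerA
  rw [← Finset.sum_sub_distrib]
  simp_rw [← Finset.sum_sub_distrib, ← mul_sub]
  refine (norm_sum_le _ _).trans ?_
  calc ∑ h ∈ Finset.Icc 1 ⌊H⌋₊, ‖∑ r ∈ (Finset.Icc 1 ⌊R⌋₊).filter (fun r => d.Coprime (c * r)),
          δ h r * (((𝐞 (((((a : ZMod (c * r)) * ((d : ZMod (c * r)))⁻¹).val : ℕ) : ℝ) * h /
            ((c * r : ℕ) : ℝ)) : Circle) : ℂ) -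
            ((𝐞 ((((((-a : ℤ) : ZMod d) * (((c * r : ℕ) : ZMod d))⁻¹).val : ℕ) : ℝ) * h * 1 / d) :
              Circle) : ℂ))‖
      ≤ ∑ h ∈ Finset.Icc 1 ⌊H⌋₊, ∑ r ∈ Finset.Icc 1 ⌊R⌋₊,
          2 * π * (|(a : ℝ)| * h / ((c : ℝ) * d * r)) := by
        refine Finset.sum_le_sum fun h _ => (norm_sum_le _ _).trans ?_
        refine le_trans (Finset.sum_le_sum fun r hr => ?_)
          (Finset.sum_le_sum_of_subset_of_nonneg (Finset.filter_subset _ _) fun r _ _ => by positivity)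
        rw [Finset.mem_filter, Finset.mem_Icc] at hr
        have hr0 : 0 < r := hr.1.1
        rw [norm_mul]
        calc ‖δ h r‖ * _ ≤ 1 * (2 * π * (|(a : ℝ)| * h / ((c : ℝ) * d * r))) :=
              mul_le_mul (hδ h r) (norm_e_sub_e_reciprocity_le hc hd hr0 hr.2 a h) (norm_nonneg _)
                zero_le_one
          _ = _ := one_mul _
    _ ≤ ∑ h ∈ Finset.Icc 1 ⌊H⌋₊, ∑ r ∈ Finset.Icc 1 ⌊R⌋₊,
          2 * π * |(a : ℝ)| * (⌊H⌋₊ : ℝ) / ((c : ℝ) * d) := by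
        refine Finset.sum_le_sum fun h hh => Finset.sum_le_sum fun r hr => ?_
        rw [Finset.mem_Icc] at hh hr
        have hhle : (h : ℝ) ≤ ⌊H⌋₊ := by exact_mod_cast hh.2
        have hr1 : (1 : ℝ) ≤ r := by exact_mod_cast hr.1
        calc 2 * π * (|(a : ℝ)| * h / ((c : ℝ) * d * r))
            = 2 * π * |(a : ℝ)| * ((h : ℝ) / r) / ((c : ℝ) * d) := by field_simp
          _ ≤ 2 * π * |(a : ℝ)| * (⌊H⌋₊ : ℝ) / ((c : ℝ) * d) := by
              gcongr
              rw [div_le_iff₀ (by linarith)]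
              nlinarith [Nat.cast_nonneg (α := ℝ) ⌊H⌋₊]
    _ = (⌊H⌋₊ : ℝ) * (⌊R⌋₊ : ℝ) * (2 * π * |(a : ℝ)| * (⌊H⌋₊ : ℝ) / ((c : ℝ) * d)) := by
        rw [Finset.sum_const, Finset.sum_const, Nat.card_Icc, Nat.card_Icc, nsmul_eq_mul, nsmul_eq_mul]
        simp only [Nat.add_sub_cancel]
        ring
    _ = _ := by ring

/-- **`𝓔` against `𝒜`** (BFI p. 236: "`𝓔(C,D,H,R) ≤ 𝒜(D,C,1,H,R) + O((|a|H log 2RCD)²)`. To see this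
apply the 'reciprocity' relation"), in the explicit form
`𝓔(a; C,D,H,R; δ) ≤ 2𝒜(−a; D,C,1,H,R; δ) + 32π² a² ⌊H⌋⁴ ⌊R⌋²` for `|δ| ≤ 1` (the squares are
split by `|x|² ≤ 2|y|² + 2|x−y|²`, and `∑ 1/c² ≤ 2`).
[cite: BombieriFriedlanderIwaniecActa1986, §12 p. 236] -/
theorem dispE_le_dispA (a : ℤ) (C D H R : ℝ) {δ : ℕ → ℕ → ℂ} (hδ : ∀ h r, ‖δ h r‖ ≤ 1) :
    dispE a C D H R δ ≤
      2 * dispA (-a) D C 1 H R δ + 32 * π ^ 2 * (a : ℝ) ^ 2 * (⌊H⌋₊ : ℝ) ^ 4 * (⌊R⌋₊ : ℝ) ^ 2 := by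
  rw [dispE_eq, dispA_neg_one_eq, Finset.sum_comm]
  set B : ℝ := 2 * π * |(a : ℝ)| * (⌊H⌋₊ : ℝ) ^ 2 * (⌊R⌋₊ : ℝ) with hB
  have hB0 : 0 ≤ B := by positivity
  have hterm : ∀ d ∈ Finset.Icc 1 ⌊D⌋₊, ∀ c ∈ Finset.Icc 1 ⌊C⌋₊,
      ‖innerE a H R δ c d‖ ^ 2 ≤
        2 * ‖innerA a H R δ c d‖ ^ 2 + 2 * (B ^ 2 * ((1 / (c : ℝ) ^ 2) * (1 / (d : ℝ) ^ 2))) := by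
    intro d hd c hc
    rw [Finset.mem_Icc] at hd hc
    have hdiff := norm_innerE_sub_innerA_le (a := a) H R hδ hc.1 hd.1
    have hc0 : (0 : ℝ) < c := by exact_mod_cast hc.1
    have hd0 : (0 : ℝ) < d := by exact_mod_cast hd.1
    refine norm_sq_le_two_mul.trans (add_le_add le_rfl (mul_le_mul_of_nonneg_left ?_ (by norm_num)))
    calc ‖innerE a H R δ c d - innerA a H R δ c d‖ ^ 2 ≤ (B / ((c : ℝ) * d)) ^ 2 :=
          pow_le_pow_left₀ (norm_nonneg _) (by rw [hB]; exact hdiff) 2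
      _ = B ^ 2 * ((1 / (c : ℝ) ^ 2) * (1 / (d : ℝ) ^ 2)) := by field_simp
  calc ∑ d ∈ Finset.Icc 1 ⌊D⌋₊, ∑ c ∈ Finset.Icc 1 ⌊C⌋₊, ‖innerE a H R δ c d‖ ^ 2
      ≤ ∑ d ∈ Finset.Icc 1 ⌊D⌋₊, ∑ c ∈ Finset.Icc 1 ⌊C⌋₊,
          (2 * ‖innerA a H R δ c d‖ ^ 2 + 2 * (B ^ 2 * ((1 / (c : ℝ) ^ 2) * (1 / (d : ℝ) ^ 2)))) :=
        Finset.sum_le_sum fun d hd => Finset.sum_le_sum fun c hc => hterm d hd c hc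
    _ = 2 * ∑ d ∈ Finset.Icc 1 ⌊D⌋₊, ∑ c ∈ Finset.Icc 1 ⌊C⌋₊, ‖innerA a H R δ c d‖ ^ 2 +
          2 * B ^ 2 * ((∑ c ∈ Finset.Icc 1 ⌊C⌋₊, 1 / (c : ℝ) ^ 2) *
            (∑ d ∈ Finset.Icc 1 ⌊D⌋₊, 1 / (d : ℝ) ^ 2)) := by
        rw [Finset.sum_mul_sum, Finset.sum_comm (s := Finset.Icc 1 ⌊C⌋₊), Finset.mul_sum,
          Finset.mul_sum, ← Finset.sum_add_distrib]
        refine Finset.sum_congr rfl fun d _ => ?_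
        rw [Finset.mul_sum, Finset.mul_sum, ← Finset.sum_add_distrib]
        refine Finset.sum_congr rfl fun c _ => ?_
        ring
    _ ≤ 2 * ∑ d ∈ Finset.Icc 1 ⌊D⌋₊, ∑ c ∈ Finset.Icc 1 ⌊C⌋₊, ‖innerA a H R δ c d‖ ^ 2 +
          2 * B ^ 2 * (2 * 2) := by
        have h1 := sum_Icc_one_div_sq_le_two ⌊C⌋₊
        have h2 := sum_Icc_one_div_sq_le_two ⌊D⌋₊
        have h0 : 0 ≤ ∑ d ∈ Finset.Icc 1 ⌊D⌋₊, 1 / (d : ℝ) ^ 2 :=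
          Finset.sum_nonneg fun _ _ => by positivity
        have := mul_le_mul h1 h2 h0 (by norm_num)
        nlinarith [sq_nonneg B]
    _ = _ := by rw [hB]; ring_nf; rw [sq_abs]; ring


end BFI

open BFI

/-! ### Theorem 5 from Lemma 6 -/

set_option maxHeartbeats 400000 in
-- exponent bookkeeping for the reciprocity error (raised heartbeat budget)
/-- **BFI 1986, Theorem 5, from Lemma 6.**  The hypothesis is BFI's Lemma 6 (§8, (8.4) p. 227:
"Let `C, D, H, K, Q ≥ 1`, `a ≠ 0` and `ε > 0`. We then have
`𝒜(C,D,K,H,Q) ≪ (CDHKQ)^ε {CDHKQ + H(KQ)^{1/2}(H+Q)^{1/2}[C(Q²+HKQ)(C+DQ²) + C²DQ√(Q²+HKQ) + D²HKQ³]^{1/2}}`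
the constant implied in `≪` depending on `ε` and `a` only" — in the source a consequence of
Lemma 1 = Deshouillers–Iwaniec's Theorem 12), stated for `BFI.dispA` and all `|α(h,q)| ≤ 1`.
PROVED: Lemma 9 is replaced by `BFI.dispE_le_dispA` (the reciprocity step of p. 236, with the
error `32π²a²H⁴R²`, admissible in the range (12.5)) and Lemma 6 at `(D, C, 1, H, R)`, then
`BFI.lemma9Rhs_le` and `BFI.theorem5_of_dispE_bound`.
[cite: BombieriFriedlanderIwaniecActa1986, §8 Lemma 6 p. 227, §12 Theorem 5 p. 237] -/
theorem BombieriFriedlanderIwaniecTheorem5_of_lemma6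
    (h6 : ∀ a : ℤ, a ≠ 0 → ∀ η : ℝ, 0 < η → ∃ C₆ : ℝ, ∀ C D K H Q : ℝ,
      1 ≤ C → 1 ≤ D → 1 ≤ K → 1 ≤ H → 1 ≤ Q → ∀ α : ℕ → ℕ → ℂ, (∀ h q, ‖α h q‖ ≤ 1) →
        BFI.dispA a C D K H Q α ≤ C₆ * ((C * D * H * K * Q) ^ η *
          (C * D * H * K * Q + H * (K * Q) ^ (1 / 2 : ℝ) * (H + Q) ^ (1 / 2 : ℝ) *
            (C * (Q ^ 2 + H * K * Q) * (C + D * Q ^ 2) +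
              C ^ 2 * D * Q * (Q ^ 2 + H * K * Q) ^ (1 / 2 : ℝ) +
                D ^ 2 * H * K * Q ^ 3) ^ (1 / 2 : ℝ)))) :
    BombieriFriedlanderIwaniecTheorem5 := by
  refine theorem5_of_dispE_bound fun a ha ε₁ hε₁ hε₁1 => ?_
  obtain ⟨C₆, hC₆⟩ := h6 (-a) (neg_ne_zero.2 ha) (ε₁ / 40) (by positivity)
  refine ⟨2 * max C₆ 1 * 1500 + 128 * π ^ 2 * (a : ℝ) ^ 2, ?_⟩
  intro x M N Q R hx hMN hN1 hM1 hQ hR hQR h1 h2 h3 h4 hH₀ δ' hδ'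
  have hx0 : 0 < x := by linarith
  have hM0 : 0 < M := by linarith
  have hQ0 : 0 < Q := by linarith
  have hR0 : 0 < R := by linarith
  set H : ℝ := x ^ (2 * ε₁) * Q * R / M with hHdef
  have hH0 : 0 ≤ H := by positivity
  set H₀ : ℕ := ⌊H⌋₊ with hH₀def
  have hH1 : (1 : ℝ) ≤ (H₀ : ℝ) := by exact_mod_cast hH₀
  have hhH : (H₀ : ℝ) ≤ H := Nat.floor_le hH0
  set W : ℝ := x ^ (1 - ε₁) * Q * R ^ 2 / M with hWdef
  have hW0 : 0 ≤ W := by positivity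
  -- the reciprocity step
  have hrec := dispE_le_dispA a (2 * Q) (2 * N) (H₀ : ℝ) (2 * R) hδ'
  rw [Nat.floor_natCast] at hrec
  -- Lemma 6 at `(D, C, 1, H, R)`
  have hA := hC₆ (2 * N) (2 * Q) 1 (H₀ : ℝ) (2 * R) (by linarith) (by linarith) le_rfl hH1
    (by linarith) δ' hδ'
  have hL9 := lemma9Rhs_le hx hMN hN1 hM1 hQ hR hQR hε₁ hε₁1 h1 h2 h3 h4 hH₀
  have hL0 : 0 ≤ lemma9Rhs (2 * Q) (2 * N) (H₀ : ℝ) (2 * R) (ε₁ / 40) :=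
    lemma9Rhs_nonneg (by linarith) (by linarith) (by positivity) (by linarith) _
  have hL6le : (2 * N * (2 * Q) * (H₀ : ℝ) * 1 * (2 * R)) ^ (ε₁ / 40) *
      (2 * N * (2 * Q) * (H₀ : ℝ) * 1 * (2 * R) +
        (H₀ : ℝ) * (1 * (2 * R)) ^ (1 / 2 : ℝ) * ((H₀ : ℝ) + 2 * R) ^ (1 / 2 : ℝ) *
          (2 * N * ((2 * R) ^ 2 + (H₀ : ℝ) * 1 * (2 * R)) * (2 * N + 2 * Q * (2 * R) ^ 2) +
            (2 * N) ^ 2 * (2 * Q) * (2 * R) * ((2 * R) ^ 2 + (H₀ : ℝ) * 1 * (2 * R)) ^ (1 / 2 : ℝ) +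
              (2 * Q) ^ 2 * (H₀ : ℝ) * 1 * (2 * R) ^ 3) ^ (1 / 2 : ℝ)) ≤
      lemma9Rhs (2 * Q) (2 * N) (H₀ : ℝ) (2 * R) (ε₁ / 40) := by
    unfold lemma9Rhs
    have hpre : 0 ≤ (2 * Q * (2 * N) * (H₀ : ℝ) * (2 * R)) ^ (ε₁ / 40) * (H₀ : ℝ) ^ 2 := by
      positivity
    have e : (2 * N * (2 * Q) * (H₀ : ℝ) * (2 * R)) = 2 * Q * (2 * N) * (H₀ : ℝ) * (2 * R) := by
      ring
    simp only [mul_one, one_mul]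
    rw [e]
    linarith [hpre]
  have hL6_0 : 0 ≤ (2 * N * (2 * Q) * (H₀ : ℝ) * 1 * (2 * R)) ^ (ε₁ / 40) *
      (2 * N * (2 * Q) * (H₀ : ℝ) * 1 * (2 * R) +
        (H₀ : ℝ) * (1 * (2 * R)) ^ (1 / 2 : ℝ) * ((H₀ : ℝ) + 2 * R) ^ (1 / 2 : ℝ) *
          (2 * N * ((2 * R) ^ 2 + (H₀ : ℝ) * 1 * (2 * R)) * (2 * N + 2 * Q * (2 * R) ^ 2) +
            (2 * N) ^ 2 * (2 * Q) * (2 * R) * ((2 * R) ^ 2 + (H₀ : ℝ) * 1 * (2 * R)) ^ (1 / 2 : ℝ) +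
              (2 * Q) ^ 2 * (H₀ : ℝ) * 1 * (2 * R) ^ 3) ^ (1 / 2 : ℝ)) := by positivity
  have hAle : dispA (-a) (2 * N) (2 * Q) 1 (H₀ : ℝ) (2 * R) δ' ≤ max C₆ 1 * (1500 * W) := by
    refine hA.trans ?_
    calc _ ≤ max C₆ 1 * _ := mul_le_mul_of_nonneg_right (le_max_left _ _) hL6_0
      _ ≤ max C₆ 1 * lemma9Rhs (2 * Q) (2 * N) (H₀ : ℝ) (2 * R) (ε₁ / 40) :=
          mul_le_mul_of_nonneg_left hL6le (le_trans zero_le_one (le_max_right _ _))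
      _ ≤ max C₆ 1 * (1500 * W) :=
          mul_le_mul_of_nonneg_left hL9 (le_trans zero_le_one (le_max_right _ _))
  -- the reciprocity error `32π²a²H₀⁴⌊2R⌋² ≤ 128π²a² W`
  have hQM : Q / M ≤ x ^ (-(10 * ε₁)) := by
    rw [div_le_iff₀ hM0, Real.rpow_neg hx0.le, ← div_eq_inv_mul, le_div_iff₀ (by positivity)]
    linarith
  have hQR4 : Q * R ^ 4 / M ≤ x ^ (1 - 10 * ε₁) := by
    rw [div_le_iff₀ hM0]
    have e : Q * R ^ 4 = x ^ (1 - 10 * ε₁) * (x ^ (10 * ε₁) * (x⁻¹ * Q * R ^ 4)) := by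
      rw [← mul_assoc, ← Real.rpow_add hx0, show 1 - 10 * ε₁ + 10 * ε₁ = 1 by ring, Real.rpow_one]
      field_simp
    rw [e]
    exact (mul_lt_mul_of_pos_left h2 (by positivity)).le
  have hH4 : H ^ 4 * R ^ 2 ≤ W := by
    have e : H ^ 4 * R ^ 2 = x ^ (8 * ε₁) * (Q / M) ^ 2 * (Q * R ^ 4 / M) * (Q * R ^ 2 / M) := by
      rw [hHdef]
      have : x ^ (8 * ε₁) = (x ^ (2 * ε₁)) ^ 4 := by
        rw [← Real.rpow_natCast, ← Real.rpow_mul hx0.le]; ring_nf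
      rw [this]
      field_simp
    rw [e, hWdef]
    have h1' : (Q / M) ^ 2 ≤ (x ^ (-(10 * ε₁))) ^ 2 := pow_le_pow_left₀ (by positivity) hQM 2
    calc x ^ (8 * ε₁) * (Q / M) ^ 2 * (Q * R ^ 4 / M) * (Q * R ^ 2 / M)
        ≤ x ^ (8 * ε₁) * (x ^ (-(10 * ε₁))) ^ 2 * x ^ (1 - 10 * ε₁) * (Q * R ^ 2 / M) := by
          gcongr
      _ = x ^ (1 - 22 * ε₁) * (Q * R ^ 2 / M) := by
          rw [← Real.rpow_natCast, ← Real.rpow_mul hx0.le, ← Real.rpow_add hx0, ← Real.rpow_add hx0]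
          ring_nf
      _ ≤ x ^ (1 - ε₁) * (Q * R ^ 2 / M) :=
          mul_le_mul_of_nonneg_right (Real.rpow_le_rpow_of_exponent_le hx (by linarith))
            (by positivity)
      _ = x ^ (1 - ε₁) * Q * R ^ 2 / M := by ring
  have hErr : 32 * π ^ 2 * (a : ℝ) ^ 2 * (H₀ : ℝ) ^ 4 * (⌊2 * R⌋₊ : ℝ) ^ 2 ≤
      128 * π ^ 2 * (a : ℝ) ^ 2 * W := by
    have hfl : (⌊2 * R⌋₊ : ℝ) ≤ 2 * R := Nat.floor_le (by linarith)
    have hh4 : (H₀ : ℝ) ^ 4 ≤ H ^ 4 := pow_le_pow_left₀ (by positivity) hhH 4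
    calc 32 * π ^ 2 * (a : ℝ) ^ 2 * (H₀ : ℝ) ^ 4 * (⌊2 * R⌋₊ : ℝ) ^ 2
        ≤ 32 * π ^ 2 * (a : ℝ) ^ 2 * H ^ 4 * (2 * R) ^ 2 := by gcongr
      _ = 128 * π ^ 2 * (a : ℝ) ^ 2 * (H ^ 4 * R ^ 2) := by ring
      _ ≤ 128 * π ^ 2 * (a : ℝ) ^ 2 * W := mul_le_mul_of_nonneg_left hH4 (by positivity)
  calc dispE a (2 * Q) (2 * N) (H₀ : ℝ) (2 * R) δ'
      ≤ 2 * dispA (-a) (2 * N) (2 * Q) 1 (H₀ : ℝ) (2 * R) δ' +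
          32 * π ^ 2 * (a : ℝ) ^ 2 * (H₀ : ℝ) ^ 4 * (⌊2 * R⌋₊ : ℝ) ^ 2 := hrec
    _ ≤ 2 * (max C₆ 1 * (1500 * W)) + 128 * π ^ 2 * (a : ℝ) ^ 2 * W :=
        add_le_add (mul_le_mul_of_nonneg_left hAle (by norm_num)) hErr
    _ = (2 * max C₆ 1 * 1500 + 128 * π ^ 2 * (a : ℝ) ^ 2) * W := by ring

end Literature.NumberTheory.Sieve
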